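import Summits.BirchSwinnertonDyer.Rank1Residual.X11b.MaxUnramifiedRestriction
import Summits.BirchSwinnertonDyer.Rank1Residual.X11b.AnticyclotomicGoodPlaces
import Literature.NumberTheory.GaloisRepresentations.DecompositionGroupOfCompletion
import Literature.NumberTheory.GaloisRepresentations.AbsGaloisGroupCompact
import HarnessLib

/-!
# X11b, route R1 — `H¹_ur(K_v, E[p^∞]) = 0` at a good place `v ∤ p` (in the COMPLETION, i.e. the
# Poitou–Tate vocabulary), by descent of cocycles from `Γ_{K_v}` to the decomposition group

HONEST FRAMING (cell `b2b-bsdres`, run/shared/lean/b2b/bsd-rank1-residual/, verbatim in every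
file): the goal of the cell is to DELETE the COMBINATION-SHAPED residual classes of the
Birch–Swinnerton-Dyer formula for ALL analytic-rank `≤ 1` elliptic curves over `ℚ` — "full BSD
formula for every rank `≤ 1` curve in class `C`" assembled STRICTLY from published theorems — so
that the rank-`≤ 1` remainder becomes exactly the CONSTRUCTION-SHAPED classes, which are TYPED
(missing-input `Prop`s), NOT attempted. This is not "finishing BSD". Sub-cell
`b2b-bsdres-multr1-p1` (X11b, route R1 = Castella 2018 Thm. A re-proved along the author's
erratum); a RESEARCH ROUTE; no claim beyond the stated class; X11b stays CONSTRUCTION-SHAPED;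
nothing here changes a label; no named fact is minted (one definition with body — the corestriction
of a continuous homomorphism onto a subgroup equal to its range — and theorems; no `sorry`).

## What is here

Step (d) of REPORT §24 needs, at a good place `v ∤ p`, that the unramified condition of the tree
(`DiscreteGaloisModule.unramifiedSubgroup`, cohomology of the COMPLETION `K_v`) on `E[p^∞]` is
zero: `H¹_ur(K_v, E[p^∞]) = 0` ("`H¹_f(K_w, W) = 0` at `w ∤ p`", JSW17 §2.2.2; Greenberg LNM 1716
§3 Lemma 3.3, good case).  Gen 11 proved the decomposition-group form
`H¹(D_v, E[p^∞]) ↪ H¹(I_{𝔓₀}, E[p^∞])` (`resOfLe_inertia_injective_of_hasGoodReductionAt`: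
inertia acts trivially by Silverman VII.4.1(a), `Frob − 1` is onto `E[p^∞]`, `D_v` is generated by
`I` and `Frob`).  This file transports it to `Γ_{K_v}`:

* `LocBridge.exists_pullback_corestrict_eq` — DESCENT OF COCYCLES: for a continuous homomorphism
  `θ : L → G` from a compact group to a Hausdorff group (a quotient map onto its range `D`), a
  continuous crossed homomorphism on `L` (coefficients pulled back from a discrete `G`-module)
  vanishing on `ker θ` is the pull-back of a continuous crossed homomorphism on `D`.
* `LocBridge.ker_absGaloisRestrict_le_absInertia` — `ker (Γ_{K_v} → Γ_K) ≤ I_{K_v}` (an element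
  fixing `K̄` fixes every root of unity of `K̄_v`, these being algebraic: `I_{K_v}` is the fixator of
  `μ_{p'}`, `mem_absInertia_iff_smul_rootsOfUnity`).
* `LocBridge.smul_geomPrimaryTorsion_eq_of_mem_absInertia` — the LOCAL inertia group
  `I_{K_v} = absInertia K_v` acts trivially on `E(K̄)[p^∞]` at good `v ∤ p` (`I_{𝔓₀} = res I_{K_v}`,
  `inertia_adicCompletionPrime_eq_map_absInertia`, + VII.4.1(a)).
* **`LocBridge.unramifiedSubgroup_primary_eq_bot`: `unramifiedSubgroup (E[p^∞]|_{Γ_{K_v}}) 1 = ⊥`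
  for every good `v ∤ p`.**

References: [JetchevSkinnerWan2017] §2.2.2 (arXiv:1512.06894 p. 6); [GreenbergLNM1716] §3
Lemma 3.3; [SilvermanAEC2009] Prop. VII.4.1; [NeukirchANT1999] II §9 (9.6); [MilneADT2006] I §2.
-/

noncomputable section

open scoped Classical

open CategoryTheory Field NumberField IsDedekindDomain ValuativeRel
open Literature.NumberTheory.EllipticCurves Literature.NumberTheory.EllipticCurves.GreenbergSelmer
open Literature.NumberTheory.GaloisRepresentations
open Literature.NumberTheory.GaloisRepresentations.IsNonarchimedeanLocalField

universe u

namespace Summit.BirchSwinnertonDyer.Rank1Residual.X11b.LocBridge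

/-! ## §1. Descent of cocycles along a quotient map onto a subgroup -/

section Descent

variable {G L : Type u} [Group G] [TopologicalSpace G] [IsTopologicalGroup G]
  [Group L] [TopologicalSpace L] [IsTopologicalGroup L]
  (θ : L →ₜ* G) (D : Subgroup G) (hD : ∀ g : G, g ∈ D ↔ g ∈ Set.range θ)

/-- The corestriction `L → D` of `θ` onto a subgroup `D` equal to its range. [folklore] -/
def corestrict : L →ₜ* D where
  toFun l := ⟨θ l, (hD _).mpr ⟨l, rfl⟩⟩
  map_one' := Subtype.ext (map_one θ)
  map_mul' a b := Subtype.ext (map_mul θ a b)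
  continuous_toFun := θ.continuous.subtype_mk _

omit [IsTopologicalGroup G] [IsTopologicalGroup L] in
/-- Unfolding `corestrict`. [folklore] -/
@[simp]
theorem coe_corestrict_apply (l : L) : ((corestrict θ D hD l : D) : G) = θ l :=
  rfl

omit [IsTopologicalGroup G] [IsTopologicalGroup L] in
/-- The corestriction is onto. [folklore] -/
theorem corestrict_surjective : Function.Surjective (corestrict θ D hD) := by
  rintro ⟨d, hd⟩
  obtain ⟨l, rfl⟩ := (hD d).mp hd
  exact ⟨l, Subtype.ext rfl⟩

omit [IsTopologicalGroup G] [IsTopologicalGroup L] in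
/-- From a compact group to a Hausdorff group the corestriction is a quotient map (a continuous
closed surjection). [folklore] -/
theorem isQuotientMap_corestrict [CompactSpace L] [T2Space G] :
    Topology.IsQuotientMap (corestrict θ D hD) :=
  (corestrict θ D hD).continuous.isClosedMap.isQuotientMap (corestrict θ D hD).continuous
    (corestrict_surjective θ D hD)

variable {M : Type u} [AddCommGroup M] [DistribMulAction G M] [TopologicalSpace M]
  [DiscreteTopology M]

omit [IsTopologicalGroup G] [IsTopologicalGroup L] in
/-- **Descent of cocycles.**  Let `θ : L → G` be a continuous homomorphism from a compact to a
Hausdorff group, `D ≤ G` its range, `M` a discrete `G`-module and `Y` the representation of `L`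
on (a copy of) `M` through `θ` (`f` a bijective morphism from the restriction).  A continuous
crossed homomorphism `ψ : L → Y` vanishing on `ker θ` is the pull-back of a continuous crossed
homomorphism `ψ̄ : D → M`: `ψ(l n) = ψ(l)` for `θ n = 1`, so `ψ` factors through the quotient map
`L ↠ D`.  (The inflation half of inflation–restriction for `1 → ker θ → L → D → 1` with `ker θ`
acting trivially.) Serre, *Galois Cohomology*, I.§2.6. [cite: SerreGaloisCohomology1997, I §2.6 (b)] -/
theorem exists_pullback_corestrict_eq [CompactSpace L] [T2Space G] (Y : TopRep.{u} ℤ L)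
    [DiscreteTopology Y] (f : TopRep.res (corestrict θ D hD : L →* D) (discreteTopRep D M) ⟶ Y)
    (hf : Function.Bijective f.hom) (ψ : contOneCocycles Y) (hψ : ∀ n : L, θ n = 1 → ψ.1 n = 0) :
    ∃ ψ' : contOneCocycles (discreteTopRep D M),
      contOneCocycles.pullback (corestrict θ D hD) f ψ' = ψ := by
  have hsurj := corestrict_surjective θ D hD
  let e : M ≃ Y := Equiv.ofBijective f.hom hf
  -- `ψ` is constant on the fibres of the corestriction
  have hfib : ∀ l l' : L, corestrict θ D hD l = corestrict θ D hD l' → ψ.1 l' = ψ.1 l :=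
    fun l l' h ↦ by
    have hn : θ (l⁻¹ * l') = 1 := by
      rw [map_mul, map_inv, inv_mul_eq_one]
      exact (congrArg (fun d : D ↦ (d : G)) h)
    have h0 := hψ _ hn
    have h1 := ψ.2 l (l⁻¹ * l')
    rw [mul_inv_cancel_left, h0, map_zero, add_zero] at h1
    exact h1
  -- the descended function and its value on `θ l`
  let g : D → M := fun d ↦ e.symm (ψ.1 (Function.surjInv hsurj d))
  have hg : ∀ l : L, g (corestrict θ D hD l) = e.symm (ψ.1 l) := fun l ↦ by
    change e.symm (ψ.1 (Function.surjInv hsurj (corestrict θ D hD l))) = _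
    rw [hfib l _ (Function.surjInv_eq hsurj (corestrict θ D hD l)).symm]
  -- `e.symm` is additive and equivariant (inverse of the intertwining `f.hom`)
  have hadd : ∀ a b : Y, e.symm (a + b) = e.symm a + e.symm b := fun a b ↦ by
    apply e.injective
    rw [Equiv.apply_symm_apply]
    change a + b = f.hom (e.symm a + e.symm b)
    rw [map_add]
    exact congrArg₂ (· + ·) (e.apply_symm_apply a).symm (e.apply_symm_apply b).symm
  have he : ∀ (l : L) (y : Y), e.symm (Y.ρ l y) = (corestrict θ D hD l) • e.symm y := fun l y ↦ by
    apply e.injective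
    rw [Equiv.apply_symm_apply]
    change Y.ρ l y =
      f.hom ((TopRep.res (corestrict θ D hD : L →* D) (discreteTopRep D M)).ρ l (e.symm y))
    rw [TopRep.hom_comm_apply f l (e.symm y)]
    exact congrArg (Y.ρ l) (e.apply_symm_apply y).symm
  -- continuity (quotient map) and the cocycle identity
  have hcont : Continuous g := by
    rw [(isQuotientMap_corestrict θ D hD).continuous_iff]
    have : g ∘ corestrict θ D hD = fun l ↦ e.symm (ψ.1 l) := funext fun l ↦ hg l
    rw [this]
    exact continuous_of_discreteTopology.comp ψ.1.continuous
  have hcoc : ∀ d d' : D, g (d * d') = g d + (discreteTopRep D M).ρ d (g d') := fun d d' ↦ by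
    obtain ⟨l, rfl⟩ := hsurj d
    obtain ⟨l', rfl⟩ := hsurj d'
    rw [← map_mul, hg, hg, hg, ψ.2 l l', hadd, he]
    rfl
  refine ⟨⟨⟨g, hcont⟩, hcoc⟩, Subtype.ext (ContinuousMap.ext fun l ↦ ?_)⟩
  rw [contOneCocycles.pullback_apply]
  change f.hom (g (corestrict θ D hD l)) = ψ.1 l
  rw [hg]
  exact e.apply_symm_apply _

/-- **Consequence on classes**: under the hypotheses of `exists_pullback_corestrict_eq`, if
moreover the restriction `H¹(D, M) → H¹(I, M)` to a subgroup `I ≤ D` is injective and `ψ`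
vanishes on `θ⁻¹(I)` (which contains `ker θ`), then `[ψ] = 0` in `H¹(L, Y)`.
[cite: SerreGaloisCohomology1997, I §2.6 (b)] -/
theorem oneCocycleClass_eq_zero_of_descent [CompactSpace L] [T2Space G] (Y : TopRep.{u} ℤ L)
    [DiscreteTopology Y] (f : TopRep.res (corestrict θ D hD : L →* D) (discreteTopRep D M) ⟶ Y)
    (hf : Function.Bijective f.hom) {I : Subgroup G} (hID : I ≤ D)
    (hinj : Function.Injective (resOfLe M hID)) (ψ : contOneCocycles Y)
    (hψ : ∀ l : L, θ l ∈ I → ψ.1 l = 0) : oneCocycleClass Y ψ = 0 := by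
  have hker : ∀ n : L, θ n = 1 → ψ.1 n = 0 := fun n hn ↦ hψ n (by rw [hn]; exact I.one_mem)
  obtain ⟨ψ', rfl⟩ := exists_pullback_corestrict_eq θ D hD Y f hf ψ hker
  -- `ψ'` vanishes on `I` (every `i ∈ I ≤ D = range θ` is `θ l` with `θ l ∈ I`)
  have hψ'I : ∀ (i : G) (hi : i ∈ I), ψ'.1 ⟨i, hID hi⟩ = 0 := fun i hi ↦ by
    obtain ⟨l, hl⟩ := (hD i).mp (hID hi)
    have h := hψ l (hl ▸ hi)
    rw [contOneCocycles.pullback_apply] at h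
    have e : corestrict θ D hD l = ⟨i, hID hi⟩ := Subtype.ext hl
    rw [e] at h
    have h0 : f.hom (ψ'.1 ⟨i, hID hi⟩) = f.hom 0 := by rw [h, map_zero]
    exact hf.1 h0
  -- hence its restriction to `I` is `0`, so `[ψ'] = 0`, so `[ψ] = 0`
  have hres : resOfLe M hID (oneCocycleClass _ ψ') = 0 := by
    have e1 : resOfLe M hID (oneCocycleClass _ ψ') = oneCocycleClass _
        (contOneCocycles.pullback (Literature.NumberTheory.EllipticCurves.subgroupInclusion hID)
          (resHomOfEquivariant (Literature.NumberTheory.EllipticCurves.subgroupInclusion hID)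
            (AddMonoidHom.id M) (fun _ _ ↦ rfl)) ψ') :=
      map_oneCocycleClass _ _ _ ψ'
    rw [e1]
    refine (oneCocycleClass_eq_zero_iff _ _).mpr ⟨0, fun i ↦ ?_⟩
    rw [contOneCocycles.pullback_apply, map_zero, sub_zero]
    exact hψ'I i i.2
  have h0 : oneCocycleClass _ ψ' = 0 := hinj (by rw [hres, map_zero])
  rw [← map_oneCocycleClass, h0, map_zero]

end Descent

/-! ## §2. `ker (Γ_{K_v} → Γ_K) ≤ I_{K_v}`, and `I_{K_v}` acts trivially on `E[p^∞]` at good `v ∤ p` -/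

section Local

open Summit.BirchSwinnertonDyer.Rank1Residual.X11b.AcSelmer

variable {K : Type} [Field K] [NumberField K]

/-- A root of unity of `K̄_v` is in the image of the chosen embedding `K̄ → K̄_v` (it is integral
over the algebraically closed `K̄`, whose minimal polynomials are linear). [folklore] -/
theorem exists_absClosureEmbedding_eq_of_pow_eq_one (v : HeightOneSpectrum (𝓞 K)) {N : ℕ}
    (hN : N ≠ 0) {ζ : AlgebraicClosure (v.adicCompletion K)} (hζ : ζ ^ N = 1) :
    ∃ x : AlgebraicClosure K, absClosureEmbedding K (v.adicCompletion K) x = ζ := by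
  letI := absClosureAlgebra K (v.adicCompletion K)
  have hint : IsIntegral (AlgebraicClosure K) ζ :=
    IsIntegral.of_pow (Nat.pos_of_ne_zero hN) (by rw [hζ]; exact isIntegral_one)
  have hdeg : (minpoly (AlgebraicClosure K) ζ).degree = 1 :=
    IsAlgClosed.degree_eq_one_of_irreducible _ (minpoly.irreducible hint)
  obtain ⟨x, hx⟩ := minpoly.mem_range_of_degree_eq_one (AlgebraicClosure K) ζ hdeg
  exact ⟨x, hx⟩

/-- **`ker (Γ_{K_v} → Γ_K) ≤ I_{K_v}`**: an element of `Γ_{K_v}` restricting to the identity of `K̄`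
fixes every root of unity of `K̄_v` (all of them come from `K̄`), hence lies in the inertia group,
the fixator of the roots of unity of order prime to the residue characteristic
(`mem_absInertia_iff_smul_rootsOfUnity`). [cite: SerreLocalFields1979, Ch. IV §4 Cor. 2 to Prop. 16] -/
theorem mem_absInertia_of_absGaloisRestrict_eq_one (v : HeightOneSpectrum (𝓞 K))
    {σ : absoluteGaloisGroup (v.adicCompletion K)}
    (hσ : absGaloisRestrict K (v.adicCompletion K) σ = 1) : σ ∈ absInertia (v.adicCompletion K) := by
  refine mem_absInertia_iff_smul_rootsOfUnity.mpr fun N hN ζ hζ ↦ ?_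
  have hN0 : N ≠ 0 := by rintro rfl; simp at hN
  obtain ⟨x, rfl⟩ := exists_absClosureEmbedding_eq_of_pow_eq_one v hN0 hζ
  rw [← absGaloisRestrict_apply_smul, hσ, one_smul]

variable (W : WeierstrassCurve K) [W.IsElliptic] (p : ℕ)

/-- **The local inertia group acts trivially on `E(K̄)[p^∞]` at a good place `v ∤ p`**:
`res σ • Q = Q` for `σ ∈ I_{K_v} = absInertia K_v` — `res I_{K_v} = I_{𝔓₀}`
(`inertia_adicCompletionPrime_eq_map_absInertia`) and `I_{𝔓₀}` acts trivially (Silverman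
VII.4.1(a), gen-11 `smul_geomPrimaryTorsion_eq_of_mem_inertia`).
[cite: SilvermanAEC2009, Prop. VII.4.1(a)] [cite: NeukirchANT1999, Ch. II §9 Prop. (9.6)] -/
theorem smul_geomPrimaryTorsion_eq_of_mem_absInertia [Fact p.Prime] {v : HeightOneSpectrum (𝓞 K)}
    (hpv : (p : 𝓞 K) ∉ v.asIdeal) (hv : W.HasGoodReductionAt v)
    {σ : absoluteGaloisGroup (v.adicCompletion K)} (hσ : σ ∈ absInertia (v.adicCompletion K))
    (Q : W.geomPrimaryTorsion p) : absGaloisRestrict K (v.adicCompletion K) σ • Q = Q := by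
  have hmem : absGaloisRestrict K (v.adicCompletion K) σ ∈
      (adicCompletionPrime K v).inertia (absoluteGaloisGroup K) := by
    rw [inertia_adicCompletionPrime_eq_map_absInertia]
    exact ⟨σ, hσ, rfl⟩
  exact smul_geomPrimaryTorsion_eq_of_mem_inertia W p hpv hv (adicCompletionPrime_mem_primesAbove K v)
    hmem Q

/-- The same through the local module structure `E[p^∞]|_{Γ_{K_v}}`
(`GaloisRep.restrictField K_v (primaryGaloisModule W p)`). [cite: SilvermanAEC2009, Prop. VII.4.1(a)] -/
theorem restrictField_primaryGaloisModule_apply_of_mem_absInertia [Fact p.Prime]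
    {v : HeightOneSpectrum (𝓞 K)} (hpv : (p : 𝓞 K) ∉ v.asIdeal) (hv : W.HasGoodReductionAt v)
    {σ : absoluteGaloisGroup (v.adicCompletion K)} (hσ : σ ∈ absInertia (v.adicCompletion K))
    (Q : W.geomPrimaryTorsion p) :
    GaloisRep.restrictField (v.adicCompletion K) (primaryGaloisModule W p) σ Q = Q :=
  smul_geomPrimaryTorsion_eq_of_mem_absInertia W p hpv hv hσ Q

/-! ## §3. `H¹_ur(K_v, E[p^∞]) = 0` -/

/-- **`H¹_ur(K_v, E[p^∞]) = 0` at every good place `v ∤ p`** (unramified subgroup of the tree,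
cohomology of the completion; "`H¹_f(K_w, W) = 0`" for `w ∤ p`, JSW17 §2.2.2).  A class
unramified in `H¹(Γ_{K_v}, E[p^∞])` is represented by a cocycle vanishing on `I_{K_v}`
(`mem_unramifiedSubgroup_one_iff_forall_eq_zero`, inertia acting trivially), in particular on
`ker (Γ_{K_v} → D_v)`; it descends to `D_v` (`exists_pullback_corestrict_eq`), where it vanishes on
`I_{𝔓₀} = res I_{K_v}`, hence is a coboundary by gen 11's
`resOfLe_inertia_injective_of_hasGoodReductionAt` (`Frob − 1` onto `E[p^∞]`).
[cite: JetchevSkinnerWan2017, §2.2.2 (arXiv:1512.06894 p. 6)] [cite: GreenbergLNM1716, §3 Lemma 3.3 (good case)] -/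
theorem unramifiedSubgroup_primary_eq_bot [Fact p.Prime] {v : HeightOneSpectrum (𝓞 K)}
    (hpv : (p : 𝓞 K) ∉ v.asIdeal) (hv : W.HasGoodReductionAt v) :
    DiscreteGaloisModule.unramifiedSubgroup
      (GaloisRep.restrictField (v.adicCompletion K) (primaryGaloisModule W p)) 1 = ⊥ := by
  haveI : CompactSpace (absoluteGaloisGroup (v.adicCompletion K)) :=
    absoluteGaloisGroup_compactSpace _
  rw [eq_bot_iff]
  intro c hc
  obtain ⟨ψ, rfl⟩ := oneCocycleClass_surjective _ c
  rw [AddSubgroup.mem_bot]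
  -- `ψ` vanishes on the local inertia group, hence wherever `res` lands in `I_{𝔓₀}`
  have hψI := (mem_unramifiedSubgroup_one_iff_forall_eq_zero _
    (fun τ hτ Q ↦ restrictField_primaryGaloisModule_apply_of_mem_absInertia W p hpv hv hτ Q) ψ).mp hc
  have hψ : ∀ l : absoluteGaloisGroup (v.adicCompletion K),
      absGaloisRestrict K (v.adicCompletion K) l ∈
        (adicCompletionPrime K v).inertia (absoluteGaloisGroup K) → ψ.1 l = 0 := by
    intro l hl
    rw [inertia_adicCompletionPrime_eq_map_absInertia] at hl
    obtain ⟨τ, hτ, hτl⟩ := hl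
    have hτl' : absGaloisRestrict K (v.adicCompletion K) τ =
        absGaloisRestrict K (v.adicCompletion K) l := hτl
    -- `l = τ n` with `res n = 1`, `n ∈ I_{K_v}`
    have hn : absGaloisRestrict K (v.adicCompletion K) (τ⁻¹ * l) = 1 := by
      rw [map_mul, map_inv, ← hτl', inv_mul_cancel]
    have hnI := mem_absInertia_of_absGaloisRestrict_eq_one v hn
    have h := ψ.2 τ (τ⁻¹ * l)
    rw [mul_inv_cancel_left, hψI τ hτ, hψI _ hnI, map_zero, add_zero] at h
    exact h
  exact oneCocycleClass_eq_zero_of_descent (absGaloisRestrict K (v.adicCompletion K)) (decomp v)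
    (fun g ↦ (mem_decomp_iff v g).trans ⟨fun ⟨σ, h⟩ ↦ ⟨σ, h⟩, fun ⟨σ, h⟩ ↦ ⟨σ, h⟩⟩)
    (DiscreteGaloisModule.toTopRep
      (GaloisRep.restrictField (v.adicCompletion K) (primaryGaloisModule W p)))
    (TopRep.ofHom ⟨ContinuousLinearMap.id ℤ (W.geomPrimaryTorsion p), fun _ ↦ rfl⟩)
    Function.bijective_id (inertia_adicCompletionPrime_le_decomp v)
    (resOfLe_inertia_injective_of_hasGoodReductionAt W p hpv hv) ψ hψ

end Local

end Summit.BirchSwinnertonDyer.Rank1Residual.X11b.LocBridge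

end
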